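import Literature.NumberTheory.Transcendental.KZCalculusProofs
import Literature.NumberTheory.Transcendental.KZLogCalculusProofs
import Literature.NumberTheory.Transcendental.KZDominatedFamilyRelations
import Literature.NumberTheory.Transcendental.KZSemialgebraicComplex
import Literature.NumberTheory.Transcendental.SemialgebraicMapsProofs
import Literature.NumberTheory.Transcendental.EllIterRep

/-!
# Box-Stokes with algebraic corners (engine E1 of `CompleteModGammaSector`)

Lines cusp-transport-to-the-beta-world / hodge-locus-cobordism of the crux
`CompleteModGammaSector` (stmt-KontsevichZagierPeriods-14233), shared engine, stub
`stub_stokesBoxAlg` together with its stronger band form `stub_stokesBoxBand`.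

The box-Stokes move of the Kontsevich–Zagier calculus [Kontsevich–Zagier 2001, §1.2, rule (3)]:
let `r` be an integral representation over the open box `∏ᵢ (aᵢ, bᵢ) ⊆ ℝⁿ⁺¹` with real algebraic
corners, and let `H` be a `ℚ`-semialgebraic function on the Newton–Leibniz band
`(∏_{i<n} (aᵢ, bᵢ)) × [aₙ, bₙ]` (open in the base coordinates, closed in the last one) which, on
each fibre of the band over the open base box, is continuous on the closed fibre, vanishes at both
of its ends, and has derivative `r.integrand` inside. Then `[r] ∈ KZ.relations`.

Proof, by the moves only: the band representation `R = [band, 𝟙_{box} · r.integrand]` and the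
zero representation `Z` over the open base box differ by ONE Newton–Leibniz move with constant
(algebraic, hence `ℚ`-semialgebraic) edges `aₙ ≤ bₙ` and primitive `H`, whose boundary term
`H(x, bₙ) − H(x, aₙ) = 0 − 0` is the zero integrand of `Z`; so `[R] ∈ relations`. The band differs
from the open box by the two faces `{zₙ = aₙ}`, `{zₙ = bₙ}`, which are Lebesgue-null, so domain
additivity drops them (`KZ.IntegralRep.of_sub_of_restrict_mem_relations`), and on the open box the
integrand of `R` is `r.integrand` (`KZ.of_sub_of_mem_relations_of_eqOn`).

## References

* M. Kontsevich, D. Zagier, *Periods*, in: Mathematics Unlimited — 2001 and Beyond, Springer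
  (2001), §1.2, rule (3).
-/

noncomputable section
set_option linter.dupNamespace false

namespace Summit.KontsevichZagierPeriods.KontsevichZagierPeriods.CompleteModGammaSectorEngine

open MeasureTheory Set
open Literature.NumberTheory.Transcendental
open Literature.NumberTheory.Transcendental.KZ
open Literature.ModelTheory.ExponentialFields (IsSemialgebraic)

/-- An open box `∏ᵢ (cᵢ, dᵢ) ⊆ ℝᵐ` with real algebraic corners is `ℚ`-semialgebraic (real algebraic
numbers are `ℚ`-definable). [folklore] -/
private theorem isSemialgebraic_openBox {m : ℕ} {c d : Fin m → ℝ} (hc : ∀ i, IsAlgebraic ℚ (c i))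
    (hd : ∀ i, IsAlgebraic ℚ (d i)) :
    IsSemialgebraic ℚ {x : Fin m → ℝ | ∀ i, x i ∈ Ioo (c i) (d i)} := by
  have h : {x : Fin m → ℝ | ∀ i, x i ∈ Ioo (c i) (d i)} =
      ⋂ i ∈ (Finset.univ : Finset (Fin m)), ({x | c i < x i} ∩ {x | x i < d i}) := by
    ext x
    simp
  rw [h]
  exact IsSemialgebraic.biInter _ _ fun i _ =>
    (isSemialgebraic_setOf_const_lt_apply (hc i) i).inter
      (isSemialgebraic_setOf_apply_lt_const (hd i) i)

/-- The Newton–Leibniz band `(∏_{i<n} (aᵢ, bᵢ)) × [aₙ, bₙ] ⊆ ℝⁿ⁺¹` with real algebraic corners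
(open in the base coordinates, closed in the last one) is `ℚ`-semialgebraic. [folklore] -/
private theorem isSemialgebraic_band {n : ℕ} {a b : Fin (n + 1) → ℝ}
    (ha : ∀ i, IsAlgebraic ℚ (a i)) (hb : ∀ i, IsAlgebraic ℚ (b i)) :
    IsSemialgebraic ℚ {z : Fin (n + 1) → ℝ | (∀ i : Fin n, z (Fin.castSucc i) ∈
        Ioo (a (Fin.castSucc i)) (b (Fin.castSucc i))) ∧
      z (Fin.last n) ∈ Icc (a (Fin.last n)) (b (Fin.last n))} := by
  have h1 : IsSemialgebraic ℚ {z : Fin (n + 1) → ℝ | ∀ i : Fin n, z (Fin.castSucc i) ∈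
      Ioo (a (Fin.castSucc i)) (b (Fin.castSucc i))} := by
    have h : {z : Fin (n + 1) → ℝ | ∀ i : Fin n, z (Fin.castSucc i) ∈
        Ioo (a (Fin.castSucc i)) (b (Fin.castSucc i))} =
        ⋂ i ∈ (Finset.univ : Finset (Fin n)), ({z | a (Fin.castSucc i) < z (Fin.castSucc i)} ∩
          {z | z (Fin.castSucc i) < b (Fin.castSucc i)}) := by
      ext z
      simp
    rw [h]
    exact IsSemialgebraic.biInter _ _ fun i _ =>
      (isSemialgebraic_setOf_const_lt_apply (ha _) _).inter
        (isSemialgebraic_setOf_apply_lt_const (hb _) _)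
  have h2 : IsSemialgebraic ℚ {z : Fin (n + 1) → ℝ | a (Fin.last n) ≤ z (Fin.last n)} := by
    convert (isSemialgebraic_setOf_apply_lt_const (ha (Fin.last n)) (Fin.last n)).compl using 1
    ext z
    simp
  have h3 : IsSemialgebraic ℚ {z : Fin (n + 1) → ℝ | z (Fin.last n) ≤ b (Fin.last n)} := by
    convert (isSemialgebraic_setOf_const_lt_apply (hb (Fin.last n)) (Fin.last n)).compl using 1
    ext z
    simp
  convert h1.inter (h2.inter h3) using 1
  ext z
  simp only [mem_setOf_eq, mem_inter_iff, mem_Icc]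

/-- **Box-Stokes with algebraic corners, band form** (engine E1'): if `r` is an integral
representation over the open box `∏ᵢ (aᵢ, bᵢ) ⊆ ℝⁿ⁺¹` with real algebraic corners and `H` is
`ℚ`-semialgebraic on the Newton–Leibniz band `(∏_{i<n} (aᵢ, bᵢ)) × [aₙ, bₙ]`, continuous on each
closed fibre `{x} × [aₙ, bₙ]` over the open base box, vanishing at both ends of the fibre and with
`∂H/∂zₙ = r.integrand` inside, then `[r] ∈ KZ.relations`: ONE Newton–Leibniz move (rule (3)) from
the band representation `[band, 𝟙_{box} r.integrand]` to the zero representation over the base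
box, then domain additivity (rule (1)) drops the two null faces `{zₙ = aₙ}`, `{zₙ = bₙ}`.
[cite: KontsevichZagier2001, §1.2 rule (3)] -/
theorem stub_stokesBoxBand :
    ∀ (n : ℕ) (a b : Fin (n + 1) → ℝ) (r : IntegralRep (n + 1)) (H : (Fin (n + 1) → ℝ) → ℝ),
      (∀ i, a i < b i) → (∀ i, IsAlgebraic ℚ (a i)) → (∀ i, IsAlgebraic ℚ (b i)) →
      r.domain = {z | ∀ i, z i ∈ Set.Ioo (a i) (b i)} →
      IsSemialgebraicFunOn ℚ {z | (∀ i : Fin n, z (Fin.castSucc i) ∈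
          Set.Ioo (a (Fin.castSucc i)) (b (Fin.castSucc i))) ∧
        z (Fin.last n) ∈ Set.Icc (a (Fin.last n)) (b (Fin.last n))} H →
      (∀ x : Fin n → ℝ, (∀ i, x i ∈ Set.Ioo (a (Fin.castSucc i)) (b (Fin.castSucc i))) →
        ContinuousOn (fun s : ℝ => H (Fin.snoc x s)) (Set.Icc (a (Fin.last n)) (b (Fin.last n))) ∧
        H (Fin.snoc x (a (Fin.last n))) = 0 ∧ H (Fin.snoc x (b (Fin.last n))) = 0 ∧
        ∀ t ∈ Set.Ioo (a (Fin.last n)) (b (Fin.last n)),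
          HasDerivAt (fun s : ℝ => H (Fin.snoc x s)) (r.integrand (Fin.snoc x t)) t) →
      of r ∈ relations := by
  intro n a b r H hab ha hb hr hH hfib
  -- the open base box `τ` and the Newton–Leibniz band `B`
  have hτ : IsSemialgebraic ℚ
      {x : Fin n → ℝ | ∀ i, x i ∈ Ioo (a (Fin.castSucc i)) (b (Fin.castSucc i))} :=
    isSemialgebraic_openBox (c := fun i => a (Fin.castSucc i)) (d := fun i => b (Fin.castSucc i))
      (fun i => ha _) (fun i => hb _)
  have hB : IsSemialgebraic ℚ {z : Fin (n + 1) → ℝ | (∀ i : Fin n, z (Fin.castSucc i) ∈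
        Ioo (a (Fin.castSucc i)) (b (Fin.castSucc i))) ∧
      z (Fin.last n) ∈ Icc (a (Fin.last n)) (b (Fin.last n))} :=
    isSemialgebraic_band ha hb
  have hrm : MeasurableSet r.domain := IntegralRep.measurableSet_domain_holds r
  -- fibrewise membership in the open box, and the open box lies in the band
  have hsnoc : ∀ x : Fin n → ℝ, (∀ i, x i ∈ Ioo (a (Fin.castSucc i)) (b (Fin.castSucc i))) →
      ∀ t ∈ Ioo (a (Fin.last n)) (b (Fin.last n)), Fin.snoc x t ∈ r.domain := by
    intro x hx t ht
    rw [hr, mem_setOf_eq]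
    intro i
    induction i using Fin.lastCases with
    | last => simpa only [Fin.snoc_last] using ht
    | cast j => simpa only [Fin.snoc_castSucc] using hx j
  have hrB : r.domain ⊆ {z : Fin (n + 1) → ℝ | (∀ i : Fin n, z (Fin.castSucc i) ∈
        Ioo (a (Fin.castSucc i)) (b (Fin.castSucc i))) ∧
      z (Fin.last n) ∈ Icc (a (Fin.last n)) (b (Fin.last n))} := by
    rw [hr]
    intro z hz
    exact ⟨fun i => hz (Fin.castSucc i), Ioo_subset_Icc_self (hz (Fin.last n))⟩
  -- the band representation `R = [B, 𝟙_{r.domain} r.integrand]`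
  have hRsa : IsSemialgebraicFunOn ℚ {z : Fin (n + 1) → ℝ | (∀ i : Fin n, z (Fin.castSucc i) ∈
        Ioo (a (Fin.castSucc i)) (b (Fin.castSucc i))) ∧
      z (Fin.last n) ∈ Icc (a (Fin.last n)) (b (Fin.last n))} (r.domain.indicator r.integrand) := by
    have h : IsSemialgebraicFunOn ℚ (r.domain ∪ ({z : Fin (n + 1) → ℝ |
        (∀ i : Fin n, z (Fin.castSucc i) ∈ Ioo (a (Fin.castSucc i)) (b (Fin.castSucc i))) ∧
          z (Fin.last n) ∈ Icc (a (Fin.last n)) (b (Fin.last n))} \ r.domain))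
        (r.domain.indicator r.integrand) :=
      r.isSemialgebraicFunOn_integrand.union
        (isSemialgebraicFunOn_natCast (hB.diff r.isSemialgebraic_domain) 0)
        (fun z hz => indicator_of_mem hz _)
        (fun z hz => by rw [indicator_of_notMem hz.2, Nat.cast_zero])
    rwa [union_sdiff_cancel hrB] at h
  obtain ⟨R, hRd, hRi⟩ : ∃ R : IntegralRep (n + 1), R.domain = {z : Fin (n + 1) → ℝ |
      (∀ i : Fin n, z (Fin.castSucc i) ∈ Ioo (a (Fin.castSucc i)) (b (Fin.castSucc i))) ∧
        z (Fin.last n) ∈ Icc (a (Fin.last n)) (b (Fin.last n))} ∧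
      R.integrand = r.domain.indicator r.integrand :=
    ⟨⟨_, r.domain.indicator r.integrand, hB, hRsa,
      ((integrable_indicator_iff hrm).mpr r.integrableOn).integrableOn⟩, rfl, rfl⟩
  -- the zero representation `Z` over the open base box
  obtain ⟨Z, hZd, hZi⟩ := exists_zeroRep hτ
  -- ONE Newton–Leibniz move `[R] − [Z]` with constant edges `aₙ ≤ bₙ` and primitive `H`
  have hNL : of R - of Z ∈ newtonLeibnizRel := by
    refine ⟨n, R, Z, fun _ => a (Fin.last n), fun _ => b (Fin.last n), H, by rw [hRd]; exact hH,
      by rw [hZd]; exact isSemialgebraicFunOn_const_of_isAlgebraic hτ (ha _),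
      by rw [hZd]; exact isSemialgebraicFunOn_const_of_isAlgebraic hτ (hb _),
      fun _ _ => (hab _).le, ?_, ?_, ?_, ?_, rfl⟩
    · rw [hRd, hZd]
      ext z
      simp only [mem_setOf_eq, mem_Icc, Fin.init]
    · intro x hx
      rw [hZd] at hx
      exact (hfib x hx).1
    · intro x hx t ht
      rw [hZd] at hx
      rw [hRi, indicator_of_mem (hsnoc x hx t ht)]
      exact (hfib x hx).2.2.2 t ht
    · intro x hx
      rw [hZd] at hx
      simp only [hZi, Pi.zero_apply, (hfib x hx).2.1, (hfib x hx).2.2.1, sub_self]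
  have hZ : of Z ∈ relations :=
    of_mem_relations_of_eqOn_zero Z (by rw [hZi]; exact fun _ _ => rfl)
  have hR : of R ∈ relations := by
    have h := relations.add_mem (newtonLeibnizRel_subset_relations hNL) hZ
    rwa [sub_add_cancel] at h
  -- drop the two null faces `{zₙ = aₙ}`, `{zₙ = bₙ}` of the band
  have hsub : r.domain ⊆ R.domain := by
    rw [hRd]
    exact hrB
  have hvol : volume (R.domain \ r.domain) = 0 := by
    refine measure_mono_null ?_ (measure_union_null (volume_setOf_last_eq_zero (a (Fin.last n)))
      (volume_setOf_last_eq_zero (b (Fin.last n))))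
    intro z hz
    rw [hRd] at hz
    simp only [mem_union, mem_setOf_eq]
    by_contra hne
    rw [not_or] at hne
    apply hz.2
    rw [hr, mem_setOf_eq]
    intro i
    induction i using Fin.lastCases with
    | last => exact ⟨lt_of_le_of_ne hz.1.2.1 (Ne.symm hne.1), lt_of_le_of_ne hz.1.2.2 hne.2⟩
    | cast j => exact hz.1.1 j
  have h₁ : of R - of (R.restrict r.domain r.isSemialgebraic_domain hsub) ∈ relations :=
    R.of_sub_of_restrict_mem_relations r.isSemialgebraic_domain hsub hvol
  -- on the open box the integrand of `R` is `r.integrand`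
  have h₂ : of (R.restrict r.domain r.isSemialgebraic_domain hsub) - of r ∈ relations :=
    of_sub_of_mem_relations_of_eqOn rfl fun z hz => by
      rw [IntegralRep.integrand_restrict, hRi, indicator_of_mem (show z ∈ r.domain from hz)]
  have h : of r = of R - (of R - of (R.restrict r.domain r.isSemialgebraic_domain hsub)) -
      (of (R.restrict r.domain r.isSemialgebraic_domain hsub) - of r) := by
    abel
  rw [h]
  exact relations.sub_mem (relations.sub_mem hR h₁) h₂

/-- **Box-Stokes with algebraic corners** (engine E1; the support item `KZStokesBox` of route
GaussManinCertificates with the corners assumed real algebraic): if `r` is an integral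
representation over the open box `∏ᵢ (aᵢ, bᵢ) ⊆ ℝⁿ⁺¹` with real algebraic corners and `H` is a
`ℚ`-semialgebraic function on the closed box which, on each fibre `{x} × [aₙ, bₙ]` over the open
base box, is continuous, vanishes at both ends and has derivative `r.integrand` inside, then
`[r] ∈ KZ.relations`. Corollary of the band form `stub_stokesBoxBand` (the band lies in the
closed box). [cite: KontsevichZagier2001, §1.2 rule (3)] -/
theorem stub_stokesBoxAlg :
    ∀ (n : ℕ) (a b : Fin (n + 1) → ℝ) (r : IntegralRep (n + 1)) (H : (Fin (n + 1) → ℝ) → ℝ),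
      (∀ i, a i < b i) → (∀ i, IsAlgebraic ℚ (a i)) → (∀ i, IsAlgebraic ℚ (b i)) →
      r.domain = {z | ∀ i, z i ∈ Set.Ioo (a i) (b i)} →
      IsSemialgebraicFunOn ℚ {z | ∀ i, z i ∈ Set.Icc (a i) (b i)} H →
      (∀ x : Fin n → ℝ, (∀ i, x i ∈ Set.Ioo (a (Fin.castSucc i)) (b (Fin.castSucc i))) →
        ContinuousOn (fun s : ℝ => H (Fin.snoc x s)) (Set.Icc (a (Fin.last n)) (b (Fin.last n))) ∧
        H (Fin.snoc x (a (Fin.last n))) = 0 ∧ H (Fin.snoc x (b (Fin.last n))) = 0 ∧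
        ∀ t ∈ Set.Ioo (a (Fin.last n)) (b (Fin.last n)),
          HasDerivAt (fun s : ℝ => H (Fin.snoc x s)) (r.integrand (Fin.snoc x t)) t) →
      of r ∈ relations := by
  intro n a b r H hab ha hb hr hH hfib
  refine stub_stokesBoxBand n a b r H hab ha hb hr (hH.mono ?_ (isSemialgebraic_band ha hb)) hfib
  intro z hz
  rw [mem_setOf_eq]
  intro i
  induction i using Fin.lastCases with
  | last => exact hz.2
  | cast j => exact Ioo_subset_Icc_self (hz.1 j)

end Summit.KontsevichZagierPeriods.KontsevichZagierPeriods.CompleteModGammaSectorEngine
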